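import Literature.Algebra.EuclideanLattices.MRVerifierMachine
import Literature.Algebra.EuclideanLattices.MRGapCVPVerifierZInt
import HarnessLib

/-!
# The verifier machine of MR07 Thm. 5.23 computes `intAcceptsZ` once its yardstick is wide enough — proved

Topic `Algebra/EuclideanLattices` (family `pqc`). Sequel of `MRVerifierMachine.lean` (the integer verifier
`verdictF ∈ FP` of the machine-level Micciancio–Regev 2007, Thm. 5.23, with its stagewise values in saturated
arithmetic, `Spec.verdict`, and the exact values `Spec.verdict_eq` under explicit no-saturation side
conditions) and `MRGapCVPVerifierZInt.lean` (the all-integer predicate `intAcceptsZ` and its two-sided link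
with the analysed real tests). This file discharges the side conditions from ONE crude magnitude bound, as
the calling reduction will (its yardstick is a polynomial of the whole input):

* `natAbs_pow_apply_le` — entries of powers of an integer matrix: `|(M^e) i k| ≤ (n C)^e` if `|M| ≤ C`;
* `natAbs_gram_le` — `|(G Gᵀ) i k| ≤ N U²` for witnesses bounded by `U`;
* `Spec.verdict_eq_true_iff` — **the machine's verdict is `intAcceptsZ`**: for `D > 0`, `P ≥ 1` and a
  width `W` with `n²(nNU²)^{2^P} < 2^W`, `U < 2^W`, `D < 2^W`, `(100a²)^{2^P} < 2^W`, `(3ND²b²)^{2^P} < 2^W`,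
  `Spec.verdict W t D u a b P = true ↔ intAcceptsZ t a b D P u`;
* `verdictF_eq_true_iff` — hence the value of the machine on the canonical record (`verdictF z = [true] ↔ …`),
  and `verdictF_rec_oneBit`.

All proved; no named fact.

## References

* D. Micciancio, O. Regev, *Worst-case to average-case reductions based on Gaussian measures*,
  SIAM J. Comput. 37 (2007) 267–302; authors' version, Thm. 5.23 (the verifier `V`, p. 28).
* S. Arora, B. Barak, *Computational Complexity: A Modern Approach*, CUP 2009, §1.3 [AroraBarak2009].
-/

noncomputable section

namespace Literature.Algebra.EuclideanLattices

open _root_.Computability Literature.Computability.Complexity Literature.Computability.Complexity.Brick Polynomial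
open LLLMachine PRelSigPi FarCertMachine ARMachine Finset
open scoped Matrix

namespace MRVerifierMachine

/-! ### Entry bounds for powers of integer matrices -/

/-- **Entries of powers of an integer matrix**: if `|M i k| ≤ C` for all `i, k` (`M` square of size `n`),
then `|(M^e) i k| ≤ (n C)^e`. [folklore] -/
theorem natAbs_pow_apply_le {n : ℕ} {M : Matrix (Fin n) (Fin n) ℤ} {C : ℕ} (hM : ∀ i k, (M i k).natAbs ≤ C) :
    ∀ (e : ℕ) (i k : Fin n), ((M ^ e) i k).natAbs ≤ (n * C) ^ e
  | 0, i, k => by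
    rw [pow_zero, pow_zero, Matrix.one_apply]
    split_ifs <;> simp
  | e + 1, i, k => by
    rw [pow_succ, Matrix.mul_apply]
    calc (∑ l, (M ^ e) i l * M l k).natAbs ≤ ∑ l, ((M ^ e) i l * M l k).natAbs := Int.natAbs_sum_le _ _
      _ ≤ ∑ _l : Fin n, (n * C) ^ e * C := Finset.sum_le_sum fun l _ => by
          rw [Int.natAbs_mul]
          exact Nat.mul_le_mul (natAbs_pow_apply_le hM e i l) (hM l k)
      _ = (n * C) ^ (e + 1) := by
          rw [Finset.sum_const, Finset.card_univ, Fintype.card_fin, smul_eq_mul]; ring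

/-- **Entries of the moment matrix**: `|(G Gᵀ) i k| ≤ N U²` when every witness entry is at most `U`. [folklore] -/
theorem natAbs_gram_le {n N : ℕ} {u : Fin N → Fin n → ℤ} {U : ℕ} (hu : ∀ j i, (u j i).natAbs ≤ U) (i k : Fin n) :
    (Spec.gram u i k).natAbs ≤ N * U ^ 2 := by
  have h : Spec.gram u i k = ∑ j, u j i * u j k := by simp [Spec.gram, Matrix.mul_apply]
  rw [h]
  calc (∑ j, u j i * u j k).natAbs ≤ ∑ j, (u j i * u j k).natAbs := Int.natAbs_sum_le _ _
    _ ≤ ∑ _j : Fin N, U ^ 2 := Finset.sum_le_sum fun j _ => by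
        rw [Int.natAbs_mul, sq]; exact Nat.mul_le_mul (hu j i) (hu j k)
    _ = N * U ^ 2 := by rw [Finset.sum_const, Finset.card_univ, Fintype.card_fin, smul_eq_mul]

/-- Powers of the moment matrix: `|((GGᵀ)^{2^j}) i k| ≤ (n N U²)^{2^j}`. [folklore] -/
theorem natAbs_gram_pow_le {n N : ℕ} {u : Fin N → Fin n → ℤ} {U : ℕ} (hu : ∀ j i, (u j i).natAbs ≤ U) (j : ℕ) (i k : Fin n) :
    ((Spec.gram u ^ 2 ^ j) i k).natAbs ≤ (n * (N * U ^ 2)) ^ 2 ^ j :=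
  natAbs_pow_apply_le (fun i k => natAbs_gram_le hu i k) _ i k

/-- Monotonicity of `(nNU²)^{2^j}` in `j` (also when the base is `0`). [folklore] -/
theorem base_pow_two_pow_mono {b : ℕ} {j P : ℕ} (hj : j ≤ P) : b ^ 2 ^ j ≤ b ^ 2 ^ P := by
  rcases Nat.eq_zero_or_pos b with rfl | hb
  · rw [zero_pow (pow_ne_zero _ two_ne_zero), zero_pow (pow_ne_zero _ two_ne_zero)]
  · exact Nat.pow_le_pow_right hb (Nat.pow_le_pow_right two_pos hj)

/-! ### The verdict is `intAcceptsZ` -/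

/-- **The machine's verdict is `intAcceptsZ` for a wide enough yardstick.** For `D > 0`, `P ≥ 1`, witnesses
bounded by `U` and a width `W` with `n²(nNU²)^{2^P} < 2^W`, `U < 2^W`, `D < 2^W`, `(100a²)^{2^P} < 2^W`,
`(3ND²b²)^{2^P} < 2^W`: `Spec.verdict W t D u a b P = true ↔ intAcceptsZ t a b D P u`.
[cite: MicciancioRegev2007, Thm. 5.23 (the verifier V, p. 28) — integer form] -/
theorem Spec.verdict_eq_true_iff {n N W : ℕ} (t : Fin n → ℤ) {D : ℕ} (u : Fin N → Fin n → ℤ) {a : ℤ} {b P U : ℕ}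
    (hD : 0 < D) (hP : 1 ≤ P) (hu : ∀ j i, (u j i).natAbs ≤ U) (hUW : U < 2 ^ W) (hDW : D < 2 ^ W)
    (hGW : n ^ 2 * (n * (N * U ^ 2)) ^ 2 ^ P < 2 ^ W)
    (hα : (100 * (a * a)).natAbs ^ 2 ^ P < 2 ^ W)
    (hβ : (3 * (N : ℤ) * ((D : ℤ) * D) * ((b : ℤ) * b)).natAbs ^ 2 ^ P < 2 ^ W) :
    Spec.verdict W t D u a (b : ℤ) P = true ↔ MicciancioRegev2007.VerifierZ.intAcceptsZ t a b D P u := by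
  -- the base bound `(nNU²)^{2^j} ≤ n² (nNU²)^{2^P} < 2^W` (for `n ≥ 1`; for `n = 0` everything is vacuous)
  have hbase : ∀ j ≤ P, (n * (N * U ^ 2)) ^ 2 ^ j < 2 ^ W := by
    intro j hj
    rcases Nat.eq_zero_or_pos n with hn0 | hn
    · subst hn0
      simp only [zero_mul, ne_eq, pow_eq_zero_iff', OfNat.ofNat_ne_zero, false_and, not_false_eq_true, zero_pow]
      exact Nat.one_le_two_pow
    · calc (n * (N * U ^ 2)) ^ 2 ^ j ≤ (n * (N * U ^ 2)) ^ 2 ^ P := base_pow_two_pow_mono hj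
        _ ≤ n ^ 2 * (n * (N * U ^ 2)) ^ 2 ^ P := Nat.le_mul_of_pos_left _ (by positivity)
        _ < 2 ^ W := hGW
  have hu' : ∀ j i, (u j i).natAbs < 2 ^ W := fun j i => lt_of_le_of_lt (hu j i) hUW
  have hpow : ∀ j ≤ P - 1, ∀ i k, ((Spec.gram u ^ 2 ^ j) i k).natAbs < 2 ^ W := fun j hj i k =>
    lt_of_le_of_lt (natAbs_gram_pow_le hu j i k) (hbase j (hj.trans (Nat.sub_le _ _)))
  have htr : (∑ i, ∑ l, (Spec.gram u ^ 2 ^ (P - 1)) i l * (Spec.gram u ^ 2 ^ (P - 1)) i l).natAbs < 2 ^ W := by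
    have hA : ∀ i l, ((Spec.gram u ^ 2 ^ (P - 1)) i l).natAbs ≤ (n * (N * U ^ 2)) ^ 2 ^ (P - 1) := fun i l =>
      natAbs_gram_pow_le hu _ i l
    have hsq : ∀ i l, ((Spec.gram u ^ 2 ^ (P - 1)) i l * (Spec.gram u ^ 2 ^ (P - 1)) i l).natAbs ≤ (n * (N * U ^ 2)) ^ 2 ^ P := by
      intro i l
      rw [Int.natAbs_mul]
      calc ((Spec.gram u ^ 2 ^ (P - 1)) i l).natAbs * ((Spec.gram u ^ 2 ^ (P - 1)) i l).natAbs
          ≤ (n * (N * U ^ 2)) ^ 2 ^ (P - 1) * (n * (N * U ^ 2)) ^ 2 ^ (P - 1) := Nat.mul_le_mul (hA i l) (hA i l)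
        _ = (n * (N * U ^ 2)) ^ 2 ^ P := by
            rw [← pow_add]
            congr 1
            obtain ⟨P', rfl⟩ := Nat.exists_eq_add_of_le' hP
            rw [Nat.add_sub_cancel, pow_succ, Nat.mul_two]
    calc (∑ i, ∑ l, (Spec.gram u ^ 2 ^ (P - 1)) i l * (Spec.gram u ^ 2 ^ (P - 1)) i l).natAbs
        ≤ ∑ i, (∑ l, (Spec.gram u ^ 2 ^ (P - 1)) i l * (Spec.gram u ^ 2 ^ (P - 1)) i l).natAbs := Int.natAbs_sum_le _ _
      _ ≤ ∑ i, ∑ l, ((Spec.gram u ^ 2 ^ (P - 1)) i l * (Spec.gram u ^ 2 ^ (P - 1)) i l).natAbs :=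
          Finset.sum_le_sum fun i _ => Int.natAbs_sum_le _ _
      _ ≤ ∑ _i : Fin n, ∑ _l : Fin n, (n * (N * U ^ 2)) ^ 2 ^ P :=
          Finset.sum_le_sum fun i _ => Finset.sum_le_sum fun l _ => hsq i l
      _ = n ^ 2 * (n * (N * U ^ 2)) ^ 2 ^ P := by
          rw [Finset.sum_const, Finset.card_univ, Fintype.card_fin, smul_eq_mul, Finset.sum_const, Finset.card_univ,
            Fintype.card_fin, smul_eq_mul]; ring
      _ < 2 ^ W := hGW
  rw [Spec.verdict_eq t D u hD hDW hP hu' hpow htr hα hβ, Bool.and_eq_true, decide_eq_true_eq, decide_eq_true_eq]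
  unfold MicciancioRegev2007.VerifierZ.intAcceptsZ
  simp only [sq, MicciancioRegev2007.VerifierZ.residual, MicciancioRegev2007.VerifierZ.phaseNum, dotProduct, Spec.e, Spec.m,
    Spec.gram, MicciancioRegev2007.VerifierZ.sampleMat]

/-- **The value of the verifier machine on the canonical record is `intAcceptsZ`** (`n, N, P ≤ |yd|`, `D > 0`,
`P ≥ 1`, witnesses bounded by `U`, and the width conditions of `Spec.verdict_eq_true_iff` for `W = |yd|`):
`verdictF z = [true] ↔ intAcceptsZ t a b D P u`. [cite: MicciancioRegev2007, Thm. 5.23 (the verifier V, p. 28) — integer form] -/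
theorem verdictF_eq_true_iff {n N : ℕ} (yd : List Bool) (t : Fin n → ℤ) (D : ℕ) (a : ℤ) (b P : ℕ)
    (u : Fin N → Fin n → ℤ) {U : ℕ} (hn : n ≤ yd.length) (hN : N ≤ yd.length) (hPy : P ≤ yd.length) (hD : 0 < D)
    (hP : 1 ≤ P) (hu : ∀ j i, (u j i).natAbs ≤ U) (hUW : U < 2 ^ yd.length) (hDW : D < 2 ^ yd.length)
    (hGW : n ^ 2 * (n * (N * U ^ 2)) ^ 2 ^ P < 2 ^ yd.length)
    (hα : (100 * (a * a)).natAbs ^ 2 ^ P < 2 ^ yd.length)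
    (hβ : (3 * (N : ℤ) * ((D : ℤ) * D) * ((b : ℤ) * b)).natAbs ^ 2 ^ P < 2 ^ yd.length) :
    verdictF (inp yd t D a (b : ℤ) P u) = [true] ↔ MicciancioRegev2007.VerifierZ.intAcceptsZ t a b D P u := by
  rw [verdictF_rec yd t D a (b : ℤ) P u hn hN hPy hD, List.cons.injEq, ← Spec.verdict_eq_true_iff t u hD hP hu hUW hDW hGW hα hβ]
  simp

/-- The verdict is always ONE bit on the canonical record (needed to put the accepted language in `P`). [folklore] -/
theorem verdictF_rec_oneBit {n N : ℕ} (yd : List Bool) (t : Fin n → ℤ) (D : ℕ) (a b : ℤ) (P : ℕ)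
    (u : Fin N → Fin n → ℤ) (hn : n ≤ yd.length) (hN : N ≤ yd.length) (hPy : P ≤ yd.length) (hD : 0 < D) :
    ∃ bit : Bool, verdictF (inp yd t D a b P u) = [bit] :=
  ⟨_, verdictF_rec yd t D a b P u hn hN hPy hD⟩

end MRVerifierMachine

end Literature.Algebra.EuclideanLattices

end
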